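import Summits.AtomisticToContinuum.BoseEinsteinCondensation.Theorems.BECInsertionCorrectorStaticResponseBoundTruncationCompactness
import Literature.MathematicalPhysics.QuantumManyBody.PeriodicMaxFormBound
import HarnessLib

/-!
# `MaxFormBound` at `(v, N, L)` from the core approximation of BOUNDED finite-energy classes

Helper file toward the stub `stub_maxFormBound` (`MaxFormBound`) of line `uv-thomson-force-wave` of the
crux `BECInsertionCorrector.StaticResponseBound` (item stmt-AtomisticToContinuum-12057). The registered stub
asks, for every admissible `v` (hard cores allowed), `N`, `L > 0` and every unit `η ∈ L²((ℝ/ℤ)^{3N})`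
Bose-symmetric in momentum space, for
`periodicGroundStateEnergy v N L ≤ Q_v(η) := ∑ₙ (∑ₚ (2πnₚ/L)²)|⟪eₙ, η⟫|² + ∫ (W_v ∘ fromUnitTorusN L)|η|²`.
The tree proves it for INTEGRABLE interactions (`periodicGroundStateEnergy_le_maxForm`,
`Literature/…/PeriodicMaxFormBound.lean`); the hard-core case needs the approximation of a bounded
finite-energy class by `C¹` periodic Bose-symmetric functions VANISHING NEAR THE HARD SET, which is not in
the tree. Proved here (sorry-free, no new definitions):

* `maxFormBound_at_of_boundedCoreApprox` — **the reduction of `MaxFormBound` at `(v, N, L)` to the single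
  missing density statement** `BoundedCoreApprox(v, N, L)`: if every a.e.-BOUNDED Bose-symmetric class `η`
  with `Q_v(η) < ∞` is, for every `ε > 0`, `ε`-close in `L²` to the embedded class `ι₀Ψ` of a core function
  `Ψ ∈ periodicCore N L` (free embedding `ι₀` of `PeriodicFormDomain`, `v = 0`) with
  `Q_v(ι₀Ψ) ≤ Q_v(η) + ε`, then `E₀(v) ≤ Q_v(η)` for every UNIT Bose-symmetric `η`. The clamp truncations
  `clampC k ∘ η` (`PeriodicMaxFormBound.lean`: bounded, Bose-symmetric, `Q_v` not larger, `‖·‖ → ‖η‖`)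
  remove the boundedness, and the core variational principle in torus form
  (`periodicGroundStateEnergy_mul_le_maxForm_core`, valid for every measurable profile) gives
  `E₀ ‖ι₀Ψ‖² ≤ Q_v(ι₀Ψ)`.

References: B. Simon, *J. Operator Theory* 1 (1979) 37–47; [ReedSimonIV1978] Thm XIII.64.
-/

noncomputable section

namespace Summit.AtomisticToContinuum.BoseEinsteinCondensation.Cruxes.StaticResponseBound.UvThomsonForceWave

open MeasureTheory Filter UnitAddTorus
open scoped ENNReal NNReal BigOperators Topology InnerProductSpace
open Literature.MathematicalPhysics.QuantumManyBody.BoseGas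
open Literature.Analysis.FunctionSpaces Literature.Analysis.OperatorTheory

-- The measure on `ℝ/ℤ` is the Haar PROBABILITY measure, as in `PeriodicFormDomain.lean` (text of `stub_maxFormBound`).
attribute [local instance] Literature.MathematicalPhysics.QuantumManyBody.BoseGas.formDomain_measureSpace
  Literature.MathematicalPhysics.QuantumManyBody.BoseGas.formDomain_isProbabilityMeasure
  Literature.MathematicalPhysics.QuantumManyBody.BoseGas.formDomain_isProbabilityMeasure_pi

variable {N : ℕ} {L : ℝ}

/-! ### An `ℝ≥0∞` limit lemma -/

/-- If `a · (c - ε)² ≤ b + ε` for all small `ε > 0` (real `c > 0`), then `a · c² ≤ b` in `[0, ∞]`. [folklore] -/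
theorem mul_ofReal_sq_le_of_forall_pos {a b : ℝ≥0∞} {c : ℝ} (hc : 0 < c)
    (h : ∀ ε : ℝ, 0 < ε → ε < c → a * ENNReal.ofReal ((c - ε) ^ 2) ≤ b + ENNReal.ofReal ε) :
    a * ENNReal.ofReal (c ^ 2) ≤ b := by
  -- both sides are limits as `ε → 0⁺`
  have hl : Tendsto (fun ε : ℝ => a * ENNReal.ofReal ((c - ε) ^ 2)) (𝓝[>] 0) (𝓝 (a * ENNReal.ofReal (c ^ 2))) := by
    refine ENNReal.Tendsto.const_mul ?_ (Or.inl ?_)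
    · have hcont : Continuous fun ε : ℝ => ENNReal.ofReal ((c - ε) ^ 2) :=
        ENNReal.continuous_ofReal.comp ((continuous_const.sub continuous_id).pow 2)
      have := hcont.tendsto 0
      simp only [sub_zero] at this
      exact this.mono_left nhdsWithin_le_nhds
    · exact (ENNReal.ofReal_pos.2 (by positivity)).ne'
  have hr : Tendsto (fun ε : ℝ => b + ENNReal.ofReal ε) (𝓝[>] 0) (𝓝 b) := by
    have h1 : Tendsto (fun ε : ℝ => ENNReal.ofReal ε) (𝓝[>] 0) (𝓝 0) := by
      have := (ENNReal.continuous_ofReal.tendsto 0).mono_left (nhdsWithin_le_nhds (s := Set.Ioi (0 : ℝ)))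
      simpa using this
    simpa using h1.const_add b
  refine le_of_tendsto_of_tendsto hl hr ?_
  have hev : ∀ᶠ ε : ℝ in 𝓝[>] 0, ε < c := by
    have : Set.Iio c ∈ 𝓝 (0 : ℝ) := Iio_mem_nhds hc
    exact mem_nhdsWithin_of_mem_nhds this
  filter_upwards [hev, self_mem_nhdsWithin] with ε hεc hε0
  exact h ε hε0 hεc

/-! ### The reduction -/

/-- **`MaxFormBound` at `(v, N, L)` from the core approximation of bounded finite-energy classes.**
Let `L > 0`, `v` measurable, and suppose (`happrox`) that for every a.e.-bounded `η ∈ L²((ℝ/ℤ)^{3N})`,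
Bose-symmetric in momentum space, with finite spectral kinetic energy and finite potential energy
`∫ (W_v ∘ fromUnitTorusN L)|η|²`, and every `ε > 0`, there is a core function `Ψ ∈ periodicCore N L`
whose freely embedded class `ι₀Ψ` satisfies `Q_v(ι₀Ψ) ≤ Q_v(η) + ε` and `‖ι₀Ψ - η‖ ≤ ε`. Then for every
UNIT Bose-symmetric `η`, `periodicGroundStateEnergy v N L ≤ Q_v(η)`. [cite: ReedSimonIV1978, Thm. XIII.64] -/
theorem maxFormBound_at_of_boundedCoreApprox (hL : 0 < L) {v : ℝ → ℝ≥0∞} (hv : Measurable v)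
    (happrox : ∀ (η : Lp ℂ 2 (volume : Measure (UnitAddTorus (Fin N × Fin 3)))) (M : ℝ),
      (∀ᵐ t ∂(volume : Measure (UnitAddTorus (Fin N × Fin 3))), ‖(η : UnitAddTorus (Fin N × Fin 3) → ℂ) t‖ ≤ M) →
      (∀ (σ : Equiv.Perm (Fin N)) (n : Fin N × Fin 3 → ℤ),
        ⟪(mFourierLp 2 (fun p : Fin N × Fin 3 => n (σ p.1, p.2)) : Lp ℂ 2 (volume : Measure (UnitAddTorus (Fin N × Fin 3)))), η⟫_ℂ = ⟪(mFourierLp 2 n : Lp ℂ 2 (volume : Measure (UnitAddTorus (Fin N × Fin 3)))), η⟫_ℂ) →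
      (∑' n : Fin N × Fin 3 → ℤ, ENNReal.ofReal (∑ p, (2 * Real.pi * (n p : ℝ) / L) ^ 2) *
          (‖⟪(mFourierLp 2 n : Lp ℂ 2 (volume : Measure (UnitAddTorus (Fin N × Fin 3)))), η⟫_ℂ‖₊ : ℝ≥0∞) ^ 2) ≠ ⊤ →
      (∫⁻ t, periodicInteraction v L (fromUnitTorusN L t) *
          (‖(η : UnitAddTorus (Fin N × Fin 3) → ℂ) t‖₊ : ℝ≥0∞) ^ 2) ≠ ⊤ →
      ∀ ε : ℝ, 0 < ε → ∃ Ψ : periodicCore N L,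
        (∑' n : Fin N × Fin 3 → ℤ, ENNReal.ofReal (∑ p, (2 * Real.pi * (n p : ℝ) / L) ^ 2) *
            (‖⟪(mFourierLp 2 n : Lp ℂ 2 (volume : Measure (UnitAddTorus (Fin N × Fin 3)))),
              formEmbed hL measurable_zeroProfile (lintegral_periodicInteraction_zero_ne_top N L)
                ⟨graphEmbed hL measurable_zeroProfile (lintegral_periodicInteraction_zero_ne_top N L) Ψ,
                  graphEmbed_mem_formDomain _ _ _ _⟩⟫_ℂ‖₊ : ℝ≥0∞) ^ 2 +
          ∫⁻ t, periodicInteraction v L (fromUnitTorusN L t) *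
            (‖(formEmbed hL measurable_zeroProfile (lintegral_periodicInteraction_zero_ne_top N L)
                ⟨graphEmbed hL measurable_zeroProfile (lintegral_periodicInteraction_zero_ne_top N L) Ψ,
                  graphEmbed_mem_formDomain _ _ _ _⟩ : UnitAddTorus (Fin N × Fin 3) → ℂ) t‖₊ : ℝ≥0∞) ^ 2) ≤
          (∑' n : Fin N × Fin 3 → ℤ, ENNReal.ofReal (∑ p, (2 * Real.pi * (n p : ℝ) / L) ^ 2) *
              (‖⟪(mFourierLp 2 n : Lp ℂ 2 (volume : Measure (UnitAddTorus (Fin N × Fin 3)))), η⟫_ℂ‖₊ : ℝ≥0∞) ^ 2 +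
            ∫⁻ t, periodicInteraction v L (fromUnitTorusN L t) *
              (‖(η : UnitAddTorus (Fin N × Fin 3) → ℂ) t‖₊ : ℝ≥0∞) ^ 2) + ENNReal.ofReal ε ∧
        ‖formEmbed hL measurable_zeroProfile (lintegral_periodicInteraction_zero_ne_top N L)
            ⟨graphEmbed hL measurable_zeroProfile (lintegral_periodicInteraction_zero_ne_top N L) Ψ,
              graphEmbed_mem_formDomain _ _ _ _⟩ - η‖ ≤ ε)
    (η : Lp ℂ 2 (volume : Measure (UnitAddTorus (Fin N × Fin 3)))) (hη : ‖η‖ = 1)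
    (hsymm : ∀ (σ : Equiv.Perm (Fin N)) (n : Fin N × Fin 3 → ℤ),
      ⟪(mFourierLp 2 (fun p : Fin N × Fin 3 => n (σ p.1, p.2)) : Lp ℂ 2 (volume : Measure (UnitAddTorus (Fin N × Fin 3)))), η⟫_ℂ = ⟪(mFourierLp 2 n : Lp ℂ 2 (volume : Measure (UnitAddTorus (Fin N × Fin 3)))), η⟫_ℂ) :
    periodicGroundStateEnergy v N L ≤
      ∑' n : Fin N × Fin 3 → ℤ, ENNReal.ofReal (∑ p, (2 * Real.pi * (n p : ℝ) / L) ^ 2) *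
          (‖⟪(mFourierLp 2 n : Lp ℂ 2 (volume : Measure (UnitAddTorus (Fin N × Fin 3)))), η⟫_ℂ‖₊ : ℝ≥0∞) ^ 2 +
        ∫⁻ t, periodicInteraction v L (fromUnitTorusN L t) *
          (‖(η : UnitAddTorus (Fin N × Fin 3) → ℂ) t‖₊ : ℝ≥0∞) ^ 2 := by
  -- notation: the two halves of the maximal form
  set K : Lp ℂ 2 (volume : Measure (UnitAddTorus (Fin N × Fin 3))) → ℝ≥0∞ := fun x => ∑' n : Fin N × Fin 3 → ℤ, ENNReal.ofReal (∑ p, (2 * Real.pi * (n p : ℝ) / L) ^ 2) *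
      (‖⟪(mFourierLp 2 n : Lp ℂ 2 (volume : Measure (UnitAddTorus (Fin N × Fin 3)))), x⟫_ℂ‖₊ : ℝ≥0∞) ^ 2 with hKdef
  set P : Lp ℂ 2 (volume : Measure (UnitAddTorus (Fin N × Fin 3))) → ℝ≥0∞ := fun x => ∫⁻ t, periodicInteraction v L (fromUnitTorusN L t) *
      (‖(x : UnitAddTorus (Fin N × Fin 3) → ℂ) t‖₊ : ℝ≥0∞) ^ 2 with hPdef
  change periodicGroundStateEnergy v N L ≤ K η + P η
  -- the trivial direction
  by_cases hfin : K η + P η = ⊤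
  · rw [hfin]; exact le_top
  have hKη : K η ≠ ⊤ := fun h => hfin (by rw [h, top_add])
  have hPη : P η ≠ ⊤ := fun h => hfin (by rw [h, add_top])
  -- the clamp truncations
  set f : ℕ → Lp ℂ 2 (volume : Measure (UnitAddTorus (Fin N × Fin 3))) := fun k => (lipschitzWith_clampC (k : ℝ)).compLp (clampC_zero (Nat.cast_nonneg k)) η with hf
  -- `E₀ ‖f k‖² ≤ Q(η)` for every `k`
  have hk : ∀ k : ℕ, periodicGroundStateEnergy v N L * ENNReal.ofReal (‖f k‖ ^ 2) ≤ K η + P η := by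
    intro k
    have hKf : K (f k) ≤ K η := tsum_kinetic_clampLp_le η k
    have hPf : P (f k) ≤ P η := lintegral_pot_clampLp_le η k _
    have hKf' : K (f k) ≠ ⊤ := ne_top_of_le_ne_top hKη hKf
    have hPf' : P (f k) ≠ ⊤ := ne_top_of_le_ne_top hPη hPf
    rcases eq_or_lt_of_le (norm_nonneg (f k)) with h0 | hpos
    · rw [← h0]; simp
    refine (mul_ofReal_sq_le_of_forall_pos hpos fun ε hε hεc => ?_).trans (add_le_add hKf hPf)
    obtain ⟨Ψ, hQ, hdist⟩ := happrox (f k) (2 * k) (ae_norm_clampLp_le η k) (inner_symm_clampLp η k hsymm) hKf' hPf' ε hε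
    set ιΨ : Lp ℂ 2 (volume : Measure (UnitAddTorus (Fin N × Fin 3))) := formEmbed hL measurable_zeroProfile (lintegral_periodicInteraction_zero_ne_top N L)
      ⟨graphEmbed hL measurable_zeroProfile (lintegral_periodicInteraction_zero_ne_top N L) Ψ,
        graphEmbed_mem_formDomain _ _ _ _⟩ with hιΨ
    -- the core variational principle for `Ψ`
    have hcore : periodicGroundStateEnergy v N L * ENNReal.ofReal (‖ιΨ‖ ^ 2) ≤ K ιΨ + P ιΨ :=
      periodicGroundStateEnergy_mul_le_maxForm_core hL measurable_zeroProfile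
        (lintegral_periodicInteraction_zero_ne_top N L) hv Ψ
    -- `‖f k‖ - ε ≤ ‖ιΨ‖`
    have hnorm : ‖f k‖ - ε ≤ ‖ιΨ‖ := by
      have := norm_sub_norm_le (f k) ιΨ
      rw [← norm_neg, neg_sub] at hdist
      linarith [abs_sub_abs_le_abs_sub ‖f k‖ ‖ιΨ‖, abs_norm_sub_norm_le (f k) ιΨ]
    calc periodicGroundStateEnergy v N L * ENNReal.ofReal ((‖f k‖ - ε) ^ 2)
        ≤ periodicGroundStateEnergy v N L * ENNReal.ofReal (‖ιΨ‖ ^ 2) := by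
          gcongr
      _ ≤ K ιΨ + P ιΨ := hcore
      _ ≤ K (f k) + P (f k) + ENNReal.ofReal ε := hQ
  -- `‖f k‖² → ‖η‖² = 1` as `ℝ≥0∞`-integrals
  have hnorm : ∀ x : Lp ℂ 2 (volume : Measure (UnitAddTorus (Fin N × Fin 3))), ENNReal.ofReal (‖x‖ ^ 2) = ∫⁻ t, ((‖(x : UnitAddTorus (Fin N × Fin 3) → ℂ) t‖₊ : ℝ≥0∞)) ^ 2 :=
    fun x => by rw [(norm_Lp_two_sq_eq_toReal x).1, ENNReal.ofReal_toReal (norm_Lp_two_sq_eq_toReal x).2]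
  have h1 : ∫⁻ t, ((‖(η : UnitAddTorus (Fin N × Fin 3) → ℂ) t‖₊ : ℝ≥0∞)) ^ 2 = 1 := by
    rw [← hnorm, hη, one_pow, ENNReal.ofReal_one]
  simp only [hnorm] at hk
  have hlim := ENNReal.Tendsto.const_mul (tendsto_lintegral_clampLp_sq η) (Or.inl (by rw [h1]; exact one_ne_zero))
    (a := periodicGroundStateEnergy v N L)
  rw [h1, mul_one] at hlim
  exact le_of_tendsto' hlim hk

/-- **Registered helper `maxFormBound_of_boundedCoreApprox`** (the ∀-closed form of
`maxFormBound_at_of_boundedCoreApprox`, stated verbatim as registered on the crux item): `MaxFormBound` at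
`(v, N, L)` — `E₀(v) ≤ Q_v(η)` for every unit Bose-symmetric `η ∈ L²((ℝ/ℤ)^{3N})` — follows from the core
approximation of BOUNDED finite-energy classes (`BoundedCoreApprox(v, N, L)`, the displayed hypothesis).
[cite: ReedSimonIV1978, Thm. XIII.64] -/
theorem maxFormBound_of_boundedCoreApprox :
    ∀ {N : ℕ} {L : ℝ} (hL : 0 < L) {v : ℝ → ℝ≥0∞}, Measurable v →
    (∀ (η : Lp ℂ 2 (volume : Measure (UnitAddTorus (Fin N × Fin 3)))) (M : ℝ),
      (∀ᵐ t ∂(volume : Measure (UnitAddTorus (Fin N × Fin 3))), ‖(η : UnitAddTorus (Fin N × Fin 3) → ℂ) t‖ ≤ M) →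
      (∀ (σ : Equiv.Perm (Fin N)) (n : Fin N × Fin 3 → ℤ),
        ⟪(mFourierLp 2 (fun p : Fin N × Fin 3 => n (σ p.1, p.2)) : Lp ℂ 2 (volume : Measure (UnitAddTorus (Fin N × Fin 3)))), η⟫_ℂ = ⟪(mFourierLp 2 n : Lp ℂ 2 (volume : Measure (UnitAddTorus (Fin N × Fin 3)))), η⟫_ℂ) →
      (∑' n : Fin N × Fin 3 → ℤ, ENNReal.ofReal (∑ p, (2 * Real.pi * (n p : ℝ) / L) ^ 2) *
          (‖⟪(mFourierLp 2 n : Lp ℂ 2 (volume : Measure (UnitAddTorus (Fin N × Fin 3)))), η⟫_ℂ‖₊ : ℝ≥0∞) ^ 2) ≠ ⊤ →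
      (∫⁻ t, periodicInteraction v L (fromUnitTorusN L t) *
          (‖(η : UnitAddTorus (Fin N × Fin 3) → ℂ) t‖₊ : ℝ≥0∞) ^ 2) ≠ ⊤ →
      ∀ ε : ℝ, 0 < ε → ∃ Ψ : periodicCore N L,
        (∑' n : Fin N × Fin 3 → ℤ, ENNReal.ofReal (∑ p, (2 * Real.pi * (n p : ℝ) / L) ^ 2) *
            (‖⟪(mFourierLp 2 n : Lp ℂ 2 (volume : Measure (UnitAddTorus (Fin N × Fin 3)))),
              formEmbed hL measurable_zeroProfile (lintegral_periodicInteraction_zero_ne_top N L)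
                ⟨graphEmbed hL measurable_zeroProfile (lintegral_periodicInteraction_zero_ne_top N L) Ψ,
                  graphEmbed_mem_formDomain _ _ _ _⟩⟫_ℂ‖₊ : ℝ≥0∞) ^ 2 +
          ∫⁻ t, periodicInteraction v L (fromUnitTorusN L t) *
            (‖(formEmbed hL measurable_zeroProfile (lintegral_periodicInteraction_zero_ne_top N L)
                ⟨graphEmbed hL measurable_zeroProfile (lintegral_periodicInteraction_zero_ne_top N L) Ψ,
                  graphEmbed_mem_formDomain _ _ _ _⟩ : UnitAddTorus (Fin N × Fin 3) → ℂ) t‖₊ : ℝ≥0∞) ^ 2) ≤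
          (∑' n : Fin N × Fin 3 → ℤ, ENNReal.ofReal (∑ p, (2 * Real.pi * (n p : ℝ) / L) ^ 2) *
              (‖⟪(mFourierLp 2 n : Lp ℂ 2 (volume : Measure (UnitAddTorus (Fin N × Fin 3)))), η⟫_ℂ‖₊ : ℝ≥0∞) ^ 2 +
            ∫⁻ t, periodicInteraction v L (fromUnitTorusN L t) *
              (‖(η : UnitAddTorus (Fin N × Fin 3) → ℂ) t‖₊ : ℝ≥0∞) ^ 2) + ENNReal.ofReal ε ∧
        ‖formEmbed hL measurable_zeroProfile (lintegral_periodicInteraction_zero_ne_top N L)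
            ⟨graphEmbed hL measurable_zeroProfile (lintegral_periodicInteraction_zero_ne_top N L) Ψ,
              graphEmbed_mem_formDomain _ _ _ _⟩ - η‖ ≤ ε) →
    ∀ η : Lp ℂ 2 (volume : Measure (UnitAddTorus (Fin N × Fin 3))), ‖η‖ = 1 →
    (∀ (σ : Equiv.Perm (Fin N)) (n : Fin N × Fin 3 → ℤ),
      ⟪(mFourierLp 2 (fun p : Fin N × Fin 3 => n (σ p.1, p.2)) : Lp ℂ 2 (volume : Measure (UnitAddTorus (Fin N × Fin 3)))), η⟫_ℂ = ⟪(mFourierLp 2 n : Lp ℂ 2 (volume : Measure (UnitAddTorus (Fin N × Fin 3)))), η⟫_ℂ) →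
    periodicGroundStateEnergy v N L ≤
      ∑' n : Fin N × Fin 3 → ℤ, ENNReal.ofReal (∑ p, (2 * Real.pi * (n p : ℝ) / L) ^ 2) *
          (‖⟪(mFourierLp 2 n : Lp ℂ 2 (volume : Measure (UnitAddTorus (Fin N × Fin 3)))), η⟫_ℂ‖₊ : ℝ≥0∞) ^ 2 +
        ∫⁻ t, periodicInteraction v L (fromUnitTorusN L t) *
          (‖(η : UnitAddTorus (Fin N × Fin 3) → ℂ) t‖₊ : ℝ≥0∞) ^ 2 := by
  intro N L hL v hv happrox η hη hsymm
  exact maxFormBound_at_of_boundedCoreApprox hL hv happrox η hη hsymm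

end Summit.AtomisticToContinuum.BoseEinsteinCondensation.Cruxes.StaticResponseBound.UvThomsonForceWave

end
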